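import Summits.ABC.IUTFork.Joshi.TensorPacketsJoshi
import Summits.ABC.IUTFork.Joshi.LogShellsJoshiLattice
import HarnessLib

/-!
# [J-III] §9.4 — the tensor-packet codomain, IV: the MODEL FAMILY of p-adic fields with Mochizuki's log-shell lattices
# (block E of the abc-iut cell, rung LADDER-ABC:A2.E, slot T-20 = seat abc-iut-E-t20; merge-debt E-t19 ↔ E-t20 closed)

Sequel of `Summits/ABC/IUTFork/Joshi/TensorPacketsJoshi.lean` (K. Joshi, arXiv:2401.13508 **v4** = `Joshi2024ATS3`, §9.4;
render `HOME/lit/renders/Joshi-arxiv-2401.13508/`, "p.N l.a–b"). Object file: imports Joshi object files only (E-PLAN R14).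
TAKES NO SIDE on [IUTchIII] Cor. 3.12, on Joshi's claims, or on Mochizuki's report on them; typed ≠ proved; typed AS A
CANDIDATE ≠ endorsed; the cell locates / conditionally verifies — NO abc claim.

WHAT THIS FILE DOES. The first file types §9.4 over an UNBUNDLED carrier family `IQ : 𝔇.Arith → T.V → Type` (the
`ℚ_p`-log-shells `𝓘^{ℚ_p}(L'_w)_y`) with shells `I y w` and leaves (9.4.1.3) — "`𝓘^{ℚ_p}_p(L')` is the `ℚ_p`-vector space
generated by each direct summand of `𝓘_p(L')`" (p.100 l.52–53) — as the named property `IsSpanOfShell` (merge-debt slot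
T-19). Slot T-19 (seat abc-iut-E-t19) has landed the MODEL FAMILY of [J-III] Def. 9.2.1.1 / Lemma 9.2.1.4: at each place
`w` a `p_w`-adic field `L_w` with Mochizuki's log-shell `𝓘 = (p*)⁻¹·log_p(𝒪^×_{L_w})` as an additive subgroup
(`Joshi.mochizukiLogShellAddSubgroup`, `LogShellsJoshiLattice.lean`) and the `ℚ`-span property `isSpanOfShell_rat_family`
stated in exactly T-20's shape. Here the two are COMPOSED ("one `fun _ w => …` away", E-t19 07:05Z): §1 the model carriers
`modelIQ`/`modelI` (the arithmeticoid is forgotten — the model is already strictified, one field per place, as in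
(9.4.8.3)/(9.4.9.2) p.105 l.65–66) and (9.4.1.3) DISCHARGED for them (`isSpanOfShell_model`); §2 the §9.4 objects ON THE
MODEL: `𝓘_p(L') = ⊕_{w∈V_p} 𝓘(L'_w)` is the product of the log-shell lattices (`localPacket_model_mem_iff`), and
`^{S_{j+1}}𝓘^{ℚ_p}_p(L') = ⊗_{a∈S_{j+1}} (⊕_{w|p} L'_w)` — §9.4.10's display (9.4.10.1) "`= ⊗_{a∈S_{ℓ*+1}} (⊕_{w|p} L'_w) = ⊕_α E''_α`"
(p.106 l.61–81) — is, by the first file's twin construction, the product over the collections `(w_a)_{a∈S_{j+1}}` of the tensor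
products `⊗_a L'_{w_a}` (`packetQDecomposition` of the sequel file applies verbatim; recorded in the docstring, not
re-derived, to keep this file on the first file only). Flag F1 of the first file stands: the tensor products are over `ℚ`
(our S-side convention), so the summands `⊗_a L'_{w_a}` are `ℚ`-tensor products, not the `ℚ_p`-tensor products whose
splitting into p-adic FIELDS `E''_α` [IUTchIII] Prop. 3.1 (i) describes. Deliberately NOT here: anything about `Θ̃^𝓘`
(slot T-22), any TEST against S, any judgement.
-/

noncomputable section

namespace Summit.ABC.IUTFork.Joshi

open Thm311 Literature.IUT.LogThetaLattice
open scoped TensorProduct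

variable {T : ThetaIndex}

namespace TensorPacketDatum

variable (𝔇 : TensorPacketDatum T)

section Model

variable (pOf : T.V → ℕ) [∀ w, Fact (pOf w).Prime] (Lv : T.V → Type) [∀ w, NontriviallyNormedField (Lv w)]
  [∀ w, NormedAlgebra ℚ_[pOf w] (Lv w)] [∀ w, IsUltrametricDist (Lv w)] [∀ w, ProperSpace (Lv w)]
  [∀ w, CharZero (Lv w)]

/-! ## 1. The model carriers and (9.4.1.3) for them -/

/-- The MODEL carrier family for §9.4: at the place `w` the `p_w`-adic field `L'_w` itself, for every arithmeticoid `y`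
(strictified: "forgetting the `y_j` … altogether (as [Mochizuki, 2021a,b,c] does)", p.105 l.65–66) — Joshi's
`𝓘^{ℚ_p}(L'_w) = H^1_e(G_{L'_w}, ℚ_p(1)) ≅ L'_w` via (9.1.1.3)/(9.1.1.4) (p.95 l.20–52: "`H^1_f ≃ E`", "`H^1_e = H^1_f`"; slot
T-19's `BlochKatoDatum.dec`, `He_eq_Hf`), as §9.4.10 uses it ("`𝓘^{ℚ_p}_p = ⊕_{w|p} L'_w`", p.106 l.65–73), regarded as a
`ℚ`-module. [claim: Joshi2024ATS3, status: disputed] -/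
abbrev modelIQ : 𝔇.Arith → T.V → Type := fun _ w => Lv w

/-- The MODEL shells: Mochizuki's log-shell `𝓘((X/L_v, X^an/K_v)) = p⁻¹·log(𝒪^×_{L_v})` (`4⁻¹·…` at `p = 2`) of [J-III]
Def. 9.2.1.1 (p.96 l.35–50) as the additive subgroup `Joshi.mochizukiLogShellAddSubgroup` of slot T-19, at every
arithmeticoid. [claim: Joshi2024ATS3, status: disputed] -/
def modelI : ∀ (y : 𝔇.Arith) (w : T.V), AddSubgroup (𝔇.modelIQ Lv y w) :=
  fun _ w => mochizukiLogShellAddSubgroup (pOf w) (Lv w)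

omit [∀ w, CharZero (Lv w)] in
/-- The model shell at `(y, w)` is Mochizuki's log-shell of `L'_w` as a set (slot T-19's `mochizukiLogShell`). [folklore] -/
theorem coe_modelI (y : 𝔇.Arith) (w : T.V) :
    (𝔇.modelI pOf Lv y w : Set (Lv w)) = mochizukiLogShell (pOf w) (Lv w) :=
  coe_mochizukiLogShellAddSubgroup (pOf w) (Lv w)

/-- **(9.4.1.3) DISCHARGED on the model** (merge-debt E-t19 ↔ E-t20): "`𝓘^{ℚ_p}_p(L')` is the `ℚ_p`-vector space generated
by each direct summand of `𝓘_p(L')`" (p.100 l.52–53) in T-20's shape `IsSpanOfShell ℚ` — the `ℚ`-span of each log-shell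
lattice is the whole field (slot T-19's `isSpanOfShell_rat_family`). PROVED. [claim: Joshi2024ATS3, status: disputed] -/
theorem isSpanOfShell_model : 𝔇.IsSpanOfShell ℚ (𝔇.modelIQ Lv) (𝔇.modelI pOf Lv) :=
  fun _ w => isSpanOfShell_rat_family pOf Lv w

/-! ## 2. The §9.4 objects on the model -/

omit [∀ w, CharZero (Lv w)] in
/-- On the model, `𝓘_p(L')_y = ⊕_{w∈V_p} 𝓘(L'_w)` ((9.4.1.2)/(9.4.2.1)) is membership of every `V_p`-component in Mochizuki's
log-shell of `L'_w`. PROVED. [claim: Joshi2024ATS3, status: disputed] -/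
theorem localPacket_model_mem_iff (y : 𝔇.Arith) (p : T.VQ) (x : 𝔇.localPacketQ (𝔇.modelIQ Lv) y p) :
    x ∈ 𝔇.localPacket (𝔇.modelIQ Lv) (𝔇.modelI pOf Lv) y p ↔
      ∀ w : T.Fibre p, x w ∈ mochizukiLogShell (pOf w.1) (Lv w.1) := by
  simp only [localPacket, AddSubgroup.mem_pi, Set.mem_univ, true_implies]
  refine forall_congr' fun w => ?_
  rw [← SetLike.mem_coe, coe_modelI]

omit [∀ w, CharZero (Lv w)] in
/-- On the model, Def. 9.4.2.3's integral adelic `H^1_e(arith(L')_y, ℤ(1)) = ∏_{w∈V} H^1_e(arith(L'_y)_w, ℤ(1))` is the adelic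
log-shell `∏_w 𝓘(L'_w)` of [J-III] Def. 9.2.2.1 / (9.2.2.2) (p.98 l.1–6) — slot T-19's `adelicLogShell` — as print's Prop.
9.2.2.4 ((9.2.2.5), p.98 l.12–17) identifies them. PROVED (set level). [claim: Joshi2024ATS3, status: disputed] -/
theorem adelicH1e_model_mem_iff (y : 𝔇.Arith) (x : 𝔇.adelicH1eQ (𝔇.modelIQ Lv) y) :
    x ∈ 𝔇.adelicH1e (𝔇.modelIQ Lv) (𝔇.modelI pOf Lv) y ↔ x ∈ adelicLogShell pOf Lv := by
  simp only [adelicH1e, AddSubgroup.mem_pi, Set.mem_univ, true_implies, mem_adelicLogShell_iff]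
  refine forall_congr' fun w => ?_
  rw [← SetLike.mem_coe, coe_modelI]

omit [∀ w, IsUltrametricDist (Lv w)] [∀ w, ProperSpace (Lv w)] in
/-- On the model, Joshi's `^{S_{j+1}}𝓘^{ℚ_p}_p(L')` ((9.4.6.2)) is LITERALLY "`⊗_{a∈S_{j+1}} (⊕_{w|p} L'_w)`" — the left-hand
side of §9.4.10's display (9.4.10.1) (p.106 l.61–75) — as a `ℚ`-tensor product (flag F1); its decomposition "`= ⊕_α E''_α`"
into the summands indexed by the collections `(w_a)_a` is the sequel's `packetQDecomposition` (not restated here).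
Definitional. [claim: Joshi2024ATS3, status: disputed] -/
theorem packetQ_model (z : T.Label → 𝔇.Arith) (j : T.Label) (p : T.VQ) :
    𝔇.packetQ ℚ (𝔇.modelIQ Lv) z j p = (⨂[ℚ] _a : T.Caps j, ∀ w : T.Fibre p, Lv w.1) := rfl

omit [∀ w, IsUltrametricDist (Lv w)] [∀ w, ProperSpace (Lv w)] in
/-- On the model, `𝓘^ℚ_Mochizuki(L')` ((9.4.6.8)) is the product over primes `p` and labels `j ∈ {1,…,ℓ*}` of the `ℚ`-tensor
products `⊗_{a∈S_{j+1}} (⊕_{w|p} L'_w)`; `𝓘_Mochizuki(L')` inside it is generated packetwise by the pure tensors of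
log-shell elements (`IMochizukiAt` of the first file with the model shells). Definitional. [claim: Joshi2024ATS3, status: disputed] -/
theorem IQMochizukiAt_model (z : T.Label → 𝔇.Arith) :
    𝔇.IQMochizukiAt ℚ (𝔇.modelIQ Lv) z =
      ∀ (p : T.VQ) (j : T.LabelStar), ⨂[ℚ] _a : T.Caps j.1, ∀ w : T.Fibre p, Lv w.1 := rfl

/-- On the model, a pure tensor of componentwise log-shell elements lies in `^{S_{j+1}}𝓘_p(L')` ((9.4.6.1)/(9.4.6.5)): the
`ℤ_p`-level packet is inhabited by the tensors print forms. PROVED. [claim: Joshi2024ATS3, status: disputed] -/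
theorem tprod_mem_packet_model (z : T.Label → 𝔇.Arith) (j : T.Label) (p : T.VQ)
    (x : 𝔇.prodPacketQ (𝔇.modelIQ Lv) z j p) (hx : ∀ (a : T.Caps j) (w : T.Fibre p), x a w ∈ mochizukiLogShell (pOf w.1) (Lv w.1)) :
    𝔇.prodToPacket ℚ (𝔇.modelIQ Lv) z j p x ∈ 𝔇.packet ℚ (𝔇.modelIQ Lv) (𝔇.modelI pOf Lv) z j p := by
  refine 𝔇.prodToPacket_mem ℚ (𝔇.modelIQ Lv) (𝔇.modelI pOf Lv) z j p x ?_
  simp only [prodPacket, AddSubgroup.mem_pi, Set.mem_univ, true_implies]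
  exact fun a => (𝔇.localPacket_model_mem_iff pOf Lv _ p (x a)).2 (hx a)

end Model

end TensorPacketDatum

end Summit.ABC.IUTFork.Joshi

end
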